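import Literature.AnabelianGeometry.AbsoluteAnabelian.ArchimedeanReconstructionOneParameterProofs
import Literature.AnabelianGeometry.AbsoluteAnabelian.OneParameterSubgroupsPSL2RProofs
import HarnessLib

/-!
# [AbsTopIII] Cor. 2.7 (d) at `𝒜_𝕍(V^top)`, UNCONDITIONAL

PROOF-ONLY closer (abc-iut L4-t7; no definitions): the two theorems of
`ArchimedeanReconstructionOneParameterProofs` stated modulo the named fact `OneParameterSubgroupsPSL2R`
(S. Mochizuki, *Topics in absolute anabelian geometry III*, Cor. 2.7 (d) p.59, repaired reading A21-F8)
become unconditional by plugging in its kernel proof `oneParameterSubgroupsPSL2R_holds`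
(`OneParameterSubgroupsPSL2RProofs`, abc-iut-w5-d079): for an Aut-holomorphic disc `X`, and for the
Aut-holomorphic space of a non-degenerate open parallelogram of the complex plane, the one-parameter
subgroups of `Aut^hol` (compact-open topology) are classified by the two printed/repaired clauses.

HONEST FRAMING: our kernel check of classical statements of a refereed paper; nothing here bears on
[IUTchIII] Cor. 3.12.  Bib key `MochizukiAbsTopIII2015`; locators = kurims manuscript pages.
-/

noncomputable section

namespace Literature.AnabelianGeometry.AbsoluteAnabelian

open _root_.TopologicalSpace _root_.Topology _root_.Set _root_.Function
open scoped _root_.Manifold _root_.ContDiff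

/-- **[AbsTopIII] Cor. 2.7 (d), first sentence, for an Aut-holomorphic disc — unconditional**: for `X`
an Aut-holomorphic disc, in `𝒜_𝕏(X^top) = Aut^hol(X)` (compact-open topology; `≅ SL₂(ℝ)/{±1}`,
Prop. 2.2 (ii)) (1) the ranges of continuous injective homomorphisms `ℝ → Aut^hol(X)` are "precisely
the closed connected subgroups for which the complement of [the identity] fails to be connected", and
(2) the ranges of continuous non-injective non-trivial homomorphisms (compact one-parameter subgroups,
"one-dimensional tori") are precisely the closed subgroups homeomorphic to a circle.
[cite: MochizukiAbsTopIII2015, Corollary 2.7 (d) p.59] -/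
theorem oneParameterSubgroups_holAut
    (X : Type) [TopologicalSpace X] [T2Space X] [ChartedSpace ℂ X] [IsManifold 𝓘(ℂ, ℂ) ω X]
    (hX : IsAutHolDisc X) :
    letI := homeoCompactOpen (⊤ : Opens X)
    (∀ S : Subgroup (holAut (⊤ : Opens X)),
        (∃ f : Multiplicative ℝ →* holAut (⊤ : Opens X),
            Continuous f ∧ Injective f ∧ f.range = S) ↔
        (IsClosed (S : Set (holAut (⊤ : Opens X))) ∧ IsConnected (S : Set (holAut (⊤ : Opens X))) ∧
          ¬ IsPreconnected ((univ : Set S) \ {1}))) ∧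
      (∀ S : Subgroup (holAut (⊤ : Opens X)),
        (∃ f : Multiplicative ℝ →* holAut (⊤ : Opens X),
            Continuous f ∧ ¬ Injective f ∧ f ≠ 1 ∧ f.range = S) ↔
        (IsClosed (S : Set (holAut (⊤ : Opens X))) ∧ Nonempty (S ≃ₜ Circle))) :=
  oneParameterSubgroups_holAut_of oneParameterSubgroupsPSL2R_holds X hX

/-- **[AbsTopIII] Cor. 2.7 (d), first sentence, for the Aut-holomorphic space determined by a
parallelogram — unconditional**: for `V ⊆ ℂ` open with carrier a non-degenerate open parallelogram
`{z + s v + t w | 0 < s, t < 1}` (an Aut-holomorphic disc by the Riemann mapping theorem), the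
one-parameter subgroups of `𝒜_𝕍(V^top) = Aut^hol(V)` (compact-open topology) are classified by the two
clauses of the repaired reading of Cor. 2.7 (d). [cite: MochizukiAbsTopIII2015, Corollary 2.7 (d) p.59] -/
theorem oneParameterSubgroups_holAut_openParallelogram
    {z v w : ℂ} (hvw : LinearIndependent ℝ ![v, w]) (V : Opens ℂ)
    (hV : (V : Set ℂ) = openParallelogram z v w) :
    letI := homeoCompactOpen (⊤ : Opens V)
    (∀ S : Subgroup (holAut (⊤ : Opens V)),
        (∃ f : Multiplicative ℝ →* holAut (⊤ : Opens V),
            Continuous f ∧ Injective f ∧ f.range = S) ↔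
        (IsClosed (S : Set (holAut (⊤ : Opens V))) ∧ IsConnected (S : Set (holAut (⊤ : Opens V))) ∧
          ¬ IsPreconnected ((univ : Set S) \ {1}))) ∧
      (∀ S : Subgroup (holAut (⊤ : Opens V)),
        (∃ f : Multiplicative ℝ →* holAut (⊤ : Opens V),
            Continuous f ∧ ¬ Injective f ∧ f ≠ 1 ∧ f.range = S) ↔
        (IsClosed (S : Set (holAut (⊤ : Opens V))) ∧ Nonempty (S ≃ₜ Circle))) :=
  oneParameterSubgroups_holAut_openParallelogram_of oneParameterSubgroupsPSL2R_holds hvw V hV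

end Literature.AnabelianGeometry.AbsoluteAnabelian
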